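import Mathlib

/-!
# Sketch — crux-ideate stmt-CriticalPhenomena-11389, round 2, ideator 4

First-lemma signatures for the idea card `potential-darboux-picard-diamond`.
Nothing here is asserted; every `def … : Prop` is a statement the line would prove.
-/

noncomputable section

open Complex Metric Set

namespace Summit.CriticalPhenomena.CardyFormulaZ2.Cruxes.ParafermionToSLESixFamilies.Ideator4

/-- **Darboux–Picard univalence, convex-target form** (the identification engine of the card).
A function holomorphic on the unit disc and continuous on the closed disc whose boundary values lie on
the frontier of a compact convex set `K` and wind ONCE, monotonically, around an interior point `w₀`
(continuous non-decreasing argument `θ` with total increase `2π`) is injective on the disc and maps it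
onto `interior K`. Classical (argument principle / degree of the boundary map); the line applies it to
the scaling limit of the normalised parafermionic potential, whose boundary trace traverses the
explicit equiangular-turning polygon monotonically (touch probabilities ≥ 0 with side-constant
phases). -/
def DarbouxPicardConvex : Prop :=
  ∀ (Φ : ℂ → ℂ) (K : Set ℂ) (w₀ : ℂ) (θ : ℝ → ℝ),
    Convex ℝ K → IsCompact K → w₀ ∈ interior K →
    DifferentiableOn ℂ Φ (ball (0 : ℂ) 1) → ContinuousOn Φ (closedBall (0 : ℂ) 1) →
    MonotoneOn θ (Icc (0 : ℝ) (2 * Real.pi)) → ContinuousOn θ (Icc (0 : ℝ) (2 * Real.pi)) →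
    θ (2 * Real.pi) = θ 0 + 2 * Real.pi →
    (∀ t ∈ Icc (0 : ℝ) (2 * Real.pi),
        Φ (exp (t * I)) ∈ frontier K ∧
        Φ (exp (t * I)) - w₀ = (‖Φ (exp (t * I)) - w₀‖ : ℂ) * exp (θ t * I)) →
    InjOn Φ (ball (0 : ℂ) 1) ∧ Φ '' ball (0 : ℂ) 1 = interior K

/-- **Collinear-trace degeneration** (the dichotomy behind "one non-degenerate side suffices"):
if the boundary values of such a `Φ` lie on one real line, `Φ` is constant. With the previous lemma:
either every side of the image polygon has positive length (and `Φ` is the conformal map onto it), or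
the whole trace collapses — a holomorphic map cannot realise a partially collapsed equiangular polygon.
Provable now (`exp (i e^{-iα} Φ)` has unit modulus on the circle; maximum modulus both ways; open
mapping). -/
def CollinearTraceConstant : Prop :=
  ∀ (Φ : ℂ → ℂ) (α c : ℝ),
    DifferentiableOn ℂ Φ (ball (0 : ℂ) 1) → ContinuousOn Φ (closedBall (0 : ℂ) 1) →
    (∀ t : ℝ, (exp (-(α * I)) * Φ (exp (t * I))).im = c) →
    ∀ z ∈ ball (0 : ℂ) 1, Φ z = Φ 0

end Summit.CriticalPhenomena.CardyFormulaZ2.Cruxes.ParafermionToSLESixFamilies.Ideator4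

end
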